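import Summits.Ventures.YMGap.RobustBall.RobustSlabCriterion
import HarnessLib

/-!
# Robust ball (Y2), area-law side, part 3b — consistency of the robust criterion at `W = 0` with the tree's Durhuus–Fröhlich criterion

HONEST FRAMING: venture file of the cell `pub-ymgap` (QuantumFields programme), track ROBUST-BALL.  CONSISTENCY CHECK (rb-ref T1.3 shape for
the area-law currency): specialising `robust_slab_criterion` to the zero perturbation (`W = 0`, vertical range `m = 1`) returns the
tree's Durhuus–Fröhlich / Cao–Nissim–Sheffield criterion in the shape `HasAreaLaw d (fundamentalRep (Fin N)) (Nβ)` — boundary-uniform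
clustering of the (unperturbed) slab `σ`-models ⇒ Wilson's area law — with the same rate `C₂/2` as `durhuusFrohlich_areaLaw_of_slabClustering_holds`.
Also the generic conversion of a bound `A·e^{-cRT}` into the `HasAreaLaw` shape `C^{2(R+T)} e^{-cRT}` used by the ball rows.
Strong-coupling finite-lattice statement; nothing about the continuum, a mass gap, or Clay.
-/

noncomputable section

open MeasureTheory
open Literature.MathematicalPhysics.QuantumLattice (fundamentalRep continuous_fundamentalRep fundamentalRep_apply)
open Literature.MathematicalPhysics.QuantumFieldTheory
open Literature.MathematicalPhysics.QuantumFieldTheory.DurhuusFrohlich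

namespace Summit.Ventures.YMGap.RobustBall

open ProbabilityTheory

variable {n L N : ℕ}

/-- A bound `a ≤ A` becomes `a ≤ max(A,1)^k` for every `k ≥ 1` (the shape of `HasAreaLaw`'s perimeter factor). [folklore] -/
theorem le_max_one_pow_of_le'' {a A : ℝ} {k : ℕ} (hk : 1 ≤ k) (h : a ≤ A) : a ≤ max A 1 ^ k :=
  calc a ≤ A := h
    _ ≤ max A 1 := le_max_left _ _
    _ = max A 1 ^ 1 := (pow_one _).symm
    _ ≤ max A 1 ^ k := pow_le_pow_right₀ (le_max_right _ _) hk

/-- Converting `|x| ≤ A e^{-cRT}` into the `HasAreaLaw` shape `|x| ≤ max(A,1)^{2(R+T)} e^{-cRT}` (`R + T ≥ 1`). [folklore] -/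
theorem areaLaw_shape_of_le {x A c : ℝ} {R T : ℕ} (hRT : 1 ≤ R + T) (h : |x| ≤ A * Real.exp (-c * ((R : ℝ) * T))) :
    |x| ≤ max A 1 ^ (2 * (R + T)) * Real.exp (-c * ((R : ℝ) * T)) := by
  have hexp : 0 < Real.exp (-c * ((R : ℝ) * T)) := Real.exp_pos _
  have h2 : |x| / Real.exp (-c * ((R : ℝ) * T)) ≤ A := by rw [div_le_iff₀ hexp]; exact h
  have h3 := le_max_one_pow_of_le'' (k := 2 * (R + T)) (by omega) h2
  rwa [div_le_iff₀ hexp] at h3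

section Wilson

variable [NeZero L]

omit [NeZero L] in
/-- The zero perturbation has every vertical range. [folklore] -/
theorem hasVerticalRange_zero (v : Fin (n + 1)) (m : ℕ) :
    HasVerticalRange (fun _ : GaugeConfig (n + 1) L (SU N) => (0 : ℝ)) v m := by
  intro t Q r r' _; simp

/-- At `W = 0` the perturbed expectation ratio is the Wilson expectation at tree coupling `Nβ`. [folklore] -/
theorem loopRatio_zero_eq_wilsonExpectation (β : ℝ) (F : GaugeConfig (n + 1) L (SU N) → ℝ) :
    (∫ U, F U * weightW N β (fun _ => 0) U ∂(linkMeasure n L N)) / ∫ U, weightW N β (fun _ => 0) U ∂(linkMeasure n L N) =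
      wilsonExpectation (fundamentalRep (Fin N)) ((N : ℝ) * β) F := by
  rw [wilsonExpectation_eq_integral_div (fundamentalRep (Fin N)) (continuous_fundamentalRep (Fin N))]
  simp only [weightW_zero, weight]

/-- **Consistency at `W = 0`: the robust criterion returns the Durhuus–Fröhlich criterion** (CNS25 Thm 2.3 in the `HasAreaLaw` shape):
boundary-uniform clustering of the slab `σ`-models `slabMeasure N β A B` (constants `C₁`, `C₂ > 0`, uniform in `L, A, B`) implies
`HasAreaLaw (n+1) (fundamentalRep (Fin N)) (Nβ)`, with rate `C₂/2` — obtained from `robust_slab_criterion` at the zero perturbation,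
vertical range `1`. [cite: CaoNissimSheffield2025dynamical, Theorem 2.3] -/
theorem hasAreaLaw_of_slabClustering_via_robust (hN : 2 ≤ N) (β : ℝ) {C₁ C₂ : ℝ} (hC₂ : 0 < C₂)
    (hcov : ∀ (L : ℕ) [NeZero L] (A B : Edge n L → UN N) (x y : Site n L) (i j k l : Fin N) (φ ψ : ℂ → ℝ),
      (φ = Complex.re ∨ φ = Complex.im) → (ψ = Complex.re ∨ ψ = Complex.im) →
        |cov[fun Q => φ ((Q x : Matrix (Fin N) (Fin N) ℂ) i j),
            fun Q => ψ ((((Q y)⁻¹ : Matrix.specialUnitaryGroup (Fin N) ℂ) :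
              Matrix (Fin N) (Fin N) ℂ) k l); slabMeasure N β A B]| ≤ C₁ * Real.exp (-C₂ * torusGraphDist x y)) :
    HasAreaLaw (n + 1) (fundamentalRep (Fin N)) ((N : ℝ) * β) := by
  set A₀ : ℝ := max (N : ℝ) (Real.exp (C₂ / (2 * (1 : ℕ)) *
    (2 * Real.log (max (((N : ℝ) ^ 2) ^ (1 : ℕ) * (4 * C₁)) 1) / C₂) ^ 2)) with hA₀
  refine ⟨max A₀ 1, C₂ / (2 * (1 : ℕ)), by positivity, fun L _ x i j R T hij hR hT hRL hTL => ?_⟩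
  have h := robust_slab_criterion (n := n) (L := L) (W := fun _ => (0 : ℝ)) hN β measurable_const ⟨0, fun _ => by simp⟩
    (m := 1) le_rfl (fun v => hasVerticalRange_zero v 1) (fun v t U => rfl) hC₂
    (fun v t r x' y' i' j' k' l' φ ψ hφ hψ => by
      rw [slabLawW_zero, slabLaw]
      exact hcov L _ _ x' y' i' j' k' l' φ ψ hφ hψ) x hij hRL hTL
  rw [loopRatio_zero_eq_wilsonExpectation] at h
  exact areaLaw_shape_of_le (by omega) h

end Wilson

end Summit.Ventures.YMGap.RobustBall
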